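import Mathlib
import Literature.Analysis.FluidPDE.VectorCalculus
import Literature.Analysis.FluidPDE.SelfSimilar
import Literature.Analysis.FluidPDE.MildSolution
import Literature.Analysis.FluidPDE.NSBoundedMildSmoothing
import Summits.NavierStokesRegularity.NavierStokesRegularity.Theses.UnthreadedRigidityDoor
import Summits.NavierStokesRegularity.NavierStokesRegularity.Theorems.ThreadingFluxCentreJetDefs
import Summits.NavierStokesRegularity.NavierStokesRegularity.Theorems.ThreadingFluxSilentShellsTwoAxesTools
import Summits.NavierStokesRegularity.NavierStokesRegularity.Theorems.ThreadingFluxPlatonicDefs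
import Summits.NavierStokesRegularity.NavierStokesRegularity.Theorems.ThreadingFluxPlatonicSymmetryAlgebra
import Summits.NavierStokesRegularity.NavierStokesRegularity.Theorems.ThreadingFluxPlatonicWindowGlue
import Summits.NavierStokesRegularity.NavierStokesRegularity.Theorems.ThreadingFluxPlatonicAncientOseen
import HarnessLib

/-!
# Crux `PoloidalLiouville` (stmt-NavierStokesRegularity-1222, W1) / `UnthreadedRigidity` (stmt-…-27585, W2), crux idea «platonic-germ-sieve»
# (ns-idea-15 g11, V27): the W2 wiring and W1|_G ⇐ ⟨27585⟩ for EVERY symmetry class of rotations preserving no axis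

Support file (Theorems-side; seat ns-wall-eng-8 g7, cell `ns-wall-extremal`; `--supports stmt-NavierStokesRegularity-1222 --as helper`; 0 kit).
eng-8 g6's W2 wiring `Platonic.symmetricWindowRigidity_of_unthreadedRigidity` (`ThreadingFluxPlatonicWindowGlue.lean`) is octahedral: its spanning step
`fderiv_cross_all_of_octahedral` transports the one infinitesimal axis given by ⟨27585⟩ along the cube's half-turns and 3-cycle.  Here the spanning
step is done for an ARBITRARY set `G` of rotations of `ℝ³` (linear isometries preserving the cross product) that preserves no axis:

* `Platonic.submodule_eq_top_of_stable` — a non-zero subspace of `ℝ³` stable under a set `G` of linear isometries with `PreservesNoAxis G` is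
  all of `ℝ³` (a proper non-zero stable subspace is a line, or a plane whose normal line is stable — `G ⊆ O(3)` — and a stable line through
  `a ≠ 0` gives `g a = c a` for every `g ∈ G`, against `PreservesNoAxis`).
* ★ `Platonic.symmetricWindowRigidity_of_unthreadedRigidity_of_rotations : (rotation data for G) → PreservesNoAxis G → UnthreadedRigidity →
  SymmetricWindowRigidity G` — the W2 wiring for every such class: the good axial vectors `{c | DW(x)[c × x] = c × W(x) ∀ x}` of a slice form
  a SUBSPACE (`fderiv_cross_lincomb`), non-zero by ⟨27585⟩ (`TwoAxes.exists_cross_of_skew`), stable under every rotation symmetry of the slice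
  (`fderiv_cross_of_equivariant`), hence everything; then the radial lemma `eq_zero_of_fderiv_cross_all`.
* ★★ `Platonic.symmetricPoloidalLiouville_of_unthreadedRigidity_of_rotations : (rotation data for G) → FixesNoVector G → PreservesNoAxis G →
  UnthreadedRigidity → SymmetricPoloidalLiouville G` — W1 RESTRICTED TO ANY SUCH CLASS sits below the W2 door BY NAME (honest Oseen-mildness
  from `Platonic.oseenMild_of_equivariant`, `ThreadingFluxPlatonicAncientOseen.lean`).  The tetrahedral, octahedral and icosahedral rotation
  groups and all their `O(3)`-conjugates qualify (each fixes no vector and preserves no axis); the octahedral case is eng-8 g6's p722700 /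
  this seat's p725805.
* `Platonic.not_unthreadedRigidity_of_symmetricCounterexample_of_rotations` — the negation home.

HONEST LABEL: conditional glue strictly below W1/W2 (hypothesis ⟨27585⟩); `OctahedralCentreRigidity`, ⟨1222⟩, ⟨27585⟩ and NS regularity are OPEN
and NOT touched; information-grade (movement 0).  The rotation-data hypothesis is discharged in the tree for O only through the generators used by
eng-8 g6 (`cubeRot_halfTurn₀_cross`, …); typing `tetrahedral` / `icosahedral` with their rotation data is the custodian's call.

## References
* G. Koch, N. Nadirashvili, G. Seregin, V. Šverák, Acta Math. 203 (2009) 83–105, arXiv:0709.3599 (bounded ancient mild solutions).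
* L. Brandolese, Math. Ann. 329 (2004) 685–706, arXiv:math/0304436 (polyhedral symmetry classes of NS flows).
-/

-- the summit and its single sub-problem share the name (CONVENTIONS §1)
set_option linter.dupNamespace false

noncomputable section

open Set Function Filter Metric MeasureTheory Module
open scoped RealInnerProductSpace Topology
open Literature.Analysis.FluidPDE
open Summit.NavierStokesRegularity.NavierStokesRegularity.Theses
open Summit.NavierStokesRegularity.NavierStokesRegularity.Theorems.PoloidalLiouville.CentreJet (E3)
open Summit.NavierStokesRegularity.NavierStokesRegularity.Theorems.PoloidalLiouville.SilentShells (TwoAxes.exists_cross_of_skew)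

namespace Summit.NavierStokesRegularity.NavierStokesRegularity.Theorems.PoloidalLiouville.Platonic

/-! ## A non-zero subspace of `ℝ³` stable under linear isometries preserving no axis is everything -/

/-- A one-dimensional subspace of `ℝ³` cannot be stable under a set of maps that preserves no axis. -/
theorem not_stable_of_finrank_eq_one {G : Set (E3 → E3)} (hGaxis : PreservesNoAxis G) (S : Submodule ℝ E3)
    (hS : finrank ℝ S = 1) (hstab : ∀ g ∈ G, ∀ c ∈ S, g c ∈ S) : False := by
  obtain ⟨v, hv0, hspan⟩ := finrank_eq_one_iff'.1 hS
  have ha0 : (v : E3) ≠ 0 := fun h => hv0 (Subtype.ext h)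
  obtain ⟨g, hg, hga⟩ := hGaxis (v : E3) ha0
  obtain ⟨c, hc⟩ := hspan ⟨g v, hstab g hg v v.2⟩
  have hc' := congrArg Subtype.val hc
  simp only [SetLike.val_smul] at hc'
  exact hga c hc'.symm

/-- **A non-zero subspace of `ℝ³` stable under a set `G` of linear isometries with `PreservesNoAxis G` is all of `ℝ³`.**  If it were proper,
either it or its orthogonal complement (stable as well, since `G ⊆ O(3)` and a stable subspace of an injective map is mapped ONTO itself) is a
stable line. -/
theorem submodule_eq_top_of_stable {G : Set (E3 → E3)} (hGiso : ∀ g ∈ G, ∃ L : E3 ≃ₗᵢ[ℝ] E3, ∀ x, L x = g x)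
    (hGaxis : PreservesNoAxis G) (V : Submodule ℝ E3) (hV : V ≠ ⊥) (hstab : ∀ g ∈ G, ∀ c ∈ V, g c ∈ V) : V = ⊤ := by
  by_contra hVtop
  have hsum : finrank ℝ V + finrank ℝ Vᗮ = 3 := by
    rw [Submodule.finrank_add_finrank_orthogonal, finrank_euclideanSpace_fin]
  have hVpos : finrank ℝ V ≠ 0 := fun h => hV (Submodule.finrank_eq_zero.1 h)
  have hVperp : Vᗮ ≠ ⊥ := fun h => hVtop (Submodule.orthogonal_eq_bot_iff.1 h)
  have hVperp_pos : finrank ℝ Vᗮ ≠ 0 := fun h => hVperp (Submodule.finrank_eq_zero.1 h)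
  -- the orthogonal complement is stable as well
  have hstab' : ∀ g ∈ G, ∀ b ∈ Vᗮ, g b ∈ Vᗮ := by
    intro g hg b hb
    obtain ⟨L, hL⟩ := hGiso g hg
    have hle : V.map (L.toLinearEquiv : E3 →ₗ[ℝ] E3) ≤ V := by
      rintro _ ⟨c, hc, rfl⟩
      have h := hstab g hg c hc
      rw [← hL] at h
      exact h
    have hmap : V.map (L.toLinearEquiv : E3 →ₗ[ℝ] E3) = V :=
      Submodule.eq_of_le_of_finrank_eq hle (LinearEquiv.finrank_map_eq _ _)
    rw [Submodule.mem_orthogonal] at hb ⊢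
    intro u hu
    rw [← hmap] at hu
    obtain ⟨u', hu', rfl⟩ := hu
    rw [← hL b]
    change ⟪L u', L b⟫ = 0
    rw [L.inner_map_map]
    exact hb u' hu'
  -- one of `V`, `Vᗮ` is a line
  rcases Nat.lt_or_ge (finrank ℝ V) 2 with h | h
  · exact not_stable_of_finrank_eq_one hGaxis V (by omega) hstab
  · exact not_stable_of_finrank_eq_one hGaxis Vᗮ (by omega) hstab'

/-! ## ★ The W2 wiring for every rotation class preserving no axis -/

/-- ★ **W2 restricted to a rotation class preserving no axis follows from ⟨27585⟩.**  Let `G` be a set of self-maps of `ℝ³` each of which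
is (the coercion of) a linear isometry preserving the cross product (a rotation), and assume `G` preserves no axis.  If `UnthreadedRigidity`
holds, then every continuous, divergence-free, bounded, Oseen-mild window solution on an open preconnected time set, unthreaded about `0` and
`G`-equivariant at every time, VANISHES identically.  (⟨27585⟩ gives one axial vector `w ≠ 0` with `DW(x)[w × x] = w × W(x)`; the good axial
vectors form a subspace stable under `G`, hence all of `ℝ³` by `submodule_eq_top_of_stable`; the radial lemma `eq_zero_of_fderiv_cross_all`
concludes.) -/
theorem symmetricWindowRigidity_of_unthreadedRigidity_of_rotations {G : Set (E3 → E3)}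
    (hGrot : ∀ g ∈ G, ∃ L : E3 ≃ₗᵢ[ℝ] E3, (∀ x, L x = g x) ∧ ∀ u v, L (cross u v) = cross (L u) (L v))
    (hGaxis : PreservesNoAxis G) (h27585 : UnthreadedRigidityDoor.UnthreadedRigidity) :
    SymmetricWindowRigidity G := by
  intro S hS hpre u hcont hdiv hmild hbdd hun hequi t ht x
  -- ⟨27585⟩ at the centre `0`: one infinitesimal axis
  obtain ⟨A, hAskew, hAne, hAeq⟩ := h27585 S hS hpre u 0 hcont hdiv hmild hbdd
    (fun t ht x => by rw [sub_zero]; exact hun t ht x)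
  have hWan : AnalyticOnNhd ℝ (u t) univ := analyticOnNhd_slice hS hpre hcont hdiv hmild hbdd ht
  have hW1 : ContDiff ℝ 1 (u t) := contDiffOn_univ.1 hWan.contDiffOn_of_completeSpace
  have hWd : Differentiable ℝ (u t) := hW1.differentiable one_ne_zero
  have hskew : ∀ x y : E3, ⟪A x, y⟫ = -⟪x, A y⟫ := by
    intro x y
    have h := hAskew (x + y)
    rw [map_add, inner_add_left, inner_add_right, inner_add_right, hAskew x, hAskew y, zero_add, add_zero] at h
    have hc : ⟪x, A y⟫ = ⟪A y, x⟫ := real_inner_comm (A y) x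
    linarith
  obtain ⟨w, hw⟩ := TwoAxes.exists_cross_of_skew A hskew
  have hw0 : w ≠ 0 := by
    intro h0
    apply hAne
    ext y i
    simp [hw y, h0, cross, crossProduct]
  have hPw : ∀ y, fderiv ℝ (u t) y (cross w y) = cross w (u t y) := fun y => by
    have h := hAeq t ht y
    rw [sub_zero, hw, hw, sub_eq_zero] at h
    exact h
  -- the good axial vectors form a `G`-stable non-zero subspace
  let V : Submodule ℝ E3 :=
    { carrier := {c | ∀ y, fderiv ℝ (u t) y (cross c y) = cross c (u t y)}
      add_mem' := fun {c₁ c₂} h₁ h₂ y => by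
        have h := fderiv_cross_lincomb h₁ h₂ 1 1 y
        simpa only [one_smul] using h
      zero_mem' := fun y => by simp [cross, crossProduct]
      smul_mem' := fun r c h y => by
        have h' := fderiv_cross_lincomb h h r 0 y
        simpa only [zero_smul, add_zero] using h' }
  have hmemV : ∀ c : E3, c ∈ V ↔ ∀ y, fderiv ℝ (u t) y (cross c y) = cross c (u t y) := fun c => Iff.rfl
  have hV : V ≠ ⊥ := by
    intro h
    have hwV : w ∈ V := (hmemV w).2 hPw
    rw [h, Submodule.mem_bot] at hwV
    exact hw0 hwV
  have hstab : ∀ g ∈ G, ∀ c ∈ V, g c ∈ V := by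
    intro g hg c hc
    obtain ⟨L, hL, hLcross⟩ := hGrot g hg
    rw [hmemV] at hc ⊢
    have hequiL : ∀ y, u t (L y) = L (u t y) := fun y => by
      rw [hL y, hL (u t y)]; exact hequi t ht g hg y
    have h := fderiv_cross_of_equivariant hWd (L : E3 →L[ℝ] E3) L.surjective
      (fun a b => hLcross a b) (fun y => hequiL y) hc
    intro y
    have hy := h y
    simp only [LinearIsometryEquiv.coe_coe''] at hy
    rw [← hL c]
    exact hy
  have hGiso : ∀ g ∈ G, ∃ L : E3 ≃ₗᵢ[ℝ] E3, ∀ x, L x = g x := fun g hg => by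
    obtain ⟨L, hL, -⟩ := hGrot g hg
    exact ⟨L, hL⟩
  have hVtop : V = ⊤ := submodule_eq_top_of_stable hGiso hGaxis V hV hstab
  have hall : ∀ c y : E3, fderiv ℝ (u t) y (cross c y) = cross c (u t y) := fun c =>
    (hmemV c).1 (hVtop ▸ Submodule.mem_top)
  have hzero : u t = 0 := eq_zero_of_fderiv_cross_all hW1 (hdiv t ht) hall
  simp [hzero]

/-- **Negation home on W2 for a rotation class.**  One non-zero `G`-equivariant, unthreaded, bounded, divergence-free Oseen-mild window
solution (G a rotation class preserving no axis) refutes ⟨27585⟩. -/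
theorem not_unthreadedRigidity_of_windowSolution_of_rotations {G : Set (E3 → E3)}
    (hGrot : ∀ g ∈ G, ∃ L : E3 ≃ₗᵢ[ℝ] E3, (∀ x, L x = g x) ∧ ∀ u v, L (cross u v) = cross (L u) (L v))
    (hGaxis : PreservesNoAxis G) {S : Set ℝ} (hS : IsOpen S) (hpre : IsPreconnected S)
    {u : ℝ → E3 → E3} (hcont : ContinuousOn (Function.uncurry u) (S ×ˢ univ))
    (hdiv : ∀ t ∈ S, VectorCalculus.IsDivFree (u t))
    (hmild : ∀ s ∈ S, ∀ t ∈ S, s < t → ∀ x, u t x =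
        Literature.Analysis.UnboundedOperators.heatExtension (u s) (t - s) x - oseenDuhamel 1 s u u t x)
    (hbdd : ∀ τ ∈ S, ∃ B : ℝ, ∀ t ∈ S, t ≤ τ → ∀ x, ‖u t x‖ ≤ B)
    (hun : ∀ t ∈ S, ∀ x, inner ℝ (curl (u t) x) x = 0) (hequi : ∀ t ∈ S, IsEquivariant G (u t))
    {t : ℝ} (ht : t ∈ S) {x : E3} (hx : u t x ≠ 0) : ¬ UnthreadedRigidityDoor.UnthreadedRigidity := fun h =>
  hx (symmetricWindowRigidity_of_unthreadedRigidity_of_rotations hGrot hGaxis h S hS hpre u hcont hdiv hmild hbdd hun hequi t ht x)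

/-! ## ★★ W1 restricted to every rotation class fixing no vector and preserving no axis, from ⟨27585⟩, BY NAME -/

/-- ★★ **`SymmetricPoloidalLiouville G` ⇐ ⟨27585⟩ for every rotation class `G` fixing no vector and preserving no axis.**  If
`UnthreadedRigidity` holds, every bounded ancient mild solution (KNSS duality class, `ν = 1`) with a.e.-strongly measurable slices, smooth on
`(−∞,0) × ℝ³`, unthreaded about `0` and `G`-equivariant at every negative time VANISHES on `t < 0`.  Honest Oseen-mildness comes from
`oseenMild_of_equivariant` (`FixesNoVector G`), the window rigidity from `symmetricWindowRigidity_of_unthreadedRigidity_of_rotations`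
(`PreservesNoAxis G`).  Covers the tetrahedral, octahedral, icosahedral rotation groups and their conjugates.  Conditional on ⟨27585⟩. -/
theorem symmetricPoloidalLiouville_of_unthreadedRigidity_of_rotations {G : Set (E3 → E3)}
    (hGrot : ∀ g ∈ G, ∃ L : E3 ≃ₗᵢ[ℝ] E3, (∀ x, L x = g x) ∧ ∀ u v, L (cross u v) = cross (L u) (L v))
    (hGfix : FixesNoVector G) (hGaxis : PreservesNoAxis G) (h27585 : UnthreadedRigidityDoor.UnthreadedRigidity) :
    SymmetricPoloidalLiouville G := by
  intro v hv hmeas hsm hun hequi t ht x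
  have hGiso : ∀ g ∈ G, ∃ L : E3 ≃ₗᵢ[ℝ] E3, ∀ x, L x = g x := fun g hg => by
    obtain ⟨L, hL, -⟩ := hGrot g hg
    exact ⟨L, hL⟩
  have hcont : ContinuousOn (Function.uncurry v) (Iio (0 : ℝ) ×ˢ (univ : Set E3)) := hsm.continuousOn
  have hmild := oseenMild_of_equivariant hGfix hGiso hv hmeas hcont hequi
  -- each negative slice is `C¹`, hence classically divergence free
  have hslice : ∀ τ < (0 : ℝ), ContDiff ℝ 1 (v τ) := by
    intro τ hτ
    have hι : ContDiff ℝ (⊤ : ℕ∞) (fun y : E3 => ((τ, y) : ℝ × E3)) := contDiff_const.prodMk contDiff_id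
    have hmem : ∀ y : E3, ((τ, y) : ℝ × E3) ∈ Iio (0 : ℝ) ×ˢ (univ : Set E3) := fun y => ⟨hτ, mem_univ y⟩
    exact (hsm.comp_contDiff hι hmem).of_le (by norm_cast)
  have hdiv : ∀ τ ∈ Iio (0 : ℝ), VectorCalculus.IsDivFree (v τ) :=
    fun τ hτ => (hv.1.1 τ hτ).isDivFree_of_contDiff (hslice τ hτ)
  have hbdd : ∀ τ ∈ Iio (0 : ℝ), ∃ B : ℝ, ∀ t ∈ Iio (0 : ℝ), t ≤ τ → ∀ y, ‖v t y‖ ≤ B := by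
    intro τ _
    obtain ⟨C, hC⟩ := hv.2
    exact ⟨C, fun t ht _ y => hC t ht y⟩
  have hun' : ∀ t ∈ Iio (0 : ℝ), ∀ y, inner ℝ (curl (v t) y) y = 0 :=
    fun t ht y => by rw [real_inner_comm]; exact hun t ht y
  have hequi' : ∀ t ∈ Iio (0 : ℝ), IsEquivariant G (v t) := fun t ht => hequi t ht
  exact symmetricWindowRigidity_of_unthreadedRigidity_of_rotations hGrot hGaxis h27585 (Iio 0) isOpen_Iio isPreconnected_Iio v
    hcont hdiv hmild hbdd hun' hequi' t ht x

/-- **Negation home on W1 for a rotation class.**  A member of `SymmetricCounterexample G` (G a rotation class fixing no vector and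
preserving no axis) refutes ⟨27585⟩ `UnthreadedRigidity`. -/
theorem not_unthreadedRigidity_of_symmetricCounterexample_of_rotations {G : Set (E3 → E3)}
    (hGrot : ∀ g ∈ G, ∃ L : E3 ≃ₗᵢ[ℝ] E3, (∀ x, L x = g x) ∧ ∀ u v, L (cross u v) = cross (L u) (L v))
    (hGfix : FixesNoVector G) (hGaxis : PreservesNoAxis G) (hc : SymmetricCounterexample G) :
    ¬ UnthreadedRigidityDoor.UnthreadedRigidity := by
  intro h
  obtain ⟨v, hv, hmeas, hsm, hun, hequi, t, ht, x, hx⟩ := hc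
  exact hx (symmetricPoloidalLiouville_of_unthreadedRigidity_of_rotations hGrot hGfix hGaxis h v hv hmeas hsm hun hequi t ht x)

end Summit.NavierStokesRegularity.NavierStokesRegularity.Theorems.PoloidalLiouville.Platonic

end
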